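import Summits.Schanuel.Schanuel.Theorems.RootDecomp1KSuperellipticSiegel05

/-!
# RootDecomp1KSuperellipticSiegel — lens 1, generation 63, NODE 24 «SUPERELLIPTIC SIEGEL ON THE K-LINE — the lacunary dominant-far sector» (the superelliptic Siegel–LeVeque theorem y^m = f(x), m ≥ 3, f with two simple roots, over any number field — PROVED from the tree's unit equation via the cyclotomic–Kummer tower and Siegel's identity; the engine on DOMINANT LACUNARY pairs c_k(Y)·x^k + c₀(Y), k ≥ 3 ⇒ SiegelClause / LevelFinite / ThinFibreAt ∀ m₀ / BddLevelEmpty, intrinsically the class DomSuper P; the genus-six family T j := x³ − (Y⁷ + (4j+2)Y − (4j+2)) decided hypothesis-free ∀ j ∈ ℤ; the territory T_territory incl. 2-adic liveness by size at m₀ = 2; CLAIM L2927, PRICE L2930, K-R55) — continuation (RootDecomp1KSuperellipticSiegel06): §T part 2: (T-2) 2-adic liveness by size (den_pow_seven_le_T, den_pow_lt_T, not_thin_ineq_two_T), thinFibreAt_two_iff_levelFinite_T, the territory theorem T_territory, the pinned subfamily T′ j := T (17j) with T'_zero / T'_one / T'_territory (section Territory re-opened)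

(lens-1 g63 NODE 24 «SUPERELLIPTIC SIEGEL ON THE K-LINE — the LACUNARY DOMINANT-FAR SECTOR» L2940/L2941: HOME kernel K = HOME/decomp-schanuel-lens-1/g63/lean/SuperellipticSiegel.lean sha256 f78e5b9a…, 1410 l, ONE namespace `Summit.Schanuel.Schanuel.Theorems.RootDecomp1KSuperellipticSiegel`, imports the tree port …RootDecomp1KHyperellipticSiegel05 ONLY (node 23's part 01 carries the PROVED Literature modules SiegelCubicReduction / UnitEquationFinite / SIntegersFiniteExtension; no …Proofs umbrella, no fact file); no private, no instance, no set_option, no notation, no sorry, no decide; CLAIM L2927, census LIVENESS-v29 (rows T 0 / T 17 tabled on request, OF RECORD L2931 with the critic's territory certificate; keys domSuper / ladder / superell / galtop), crit g12 PRICE L2930 (PAYABLE THEOREM ×1 EX ANTE for (L)+(E)+(F)+(T) jointly under RULE K-R54 (iii) — the superelliptic grade, the LAST credit on the integral-points lane; CHECKLIST K-g63 (1)–(11); RULE K-R55 PRE-ANNOUNCED), writer g33 NOTE 8 L2928 (pre-check 16/16), critic VERDICT: CLEARED — THEOREM ×1 for (L)+(E)+(F)+(T) JOINTLY, ONE credit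 (RULE K-R54 (iii), the superelliptic grade — the LAST credit on the integral-points lane), VERDICT L2943 (crit-1 g12, 2026-09-01T23:12Z): CHECKLIST K-g63 (1)–(11) met item by item on the critic's own farm runs (K rc 0 · 0 errors · 0 sorries; Probe rc 0 with 253 `#print axioms` guards ⊆ the standard triple; Ctrl0 rc 0; Ctrl rc 1 = exactly the 53 planted errors; L_standalone rc 0 ⇒ §L is K-line-independent modulo node 23's Literature-only part 01); TALLY lens-1 ×21 + THEOREM ×23; RULE K-R55 FIXED ((i) toolkit ∪= superelliptic integral-point Siegel — THE INTEGRAL-POINTS LANE IS CLOSED; (ii) open territory at m₀ = 2 := K-R54 (ii) territory not reached by (i): NON-DOMINANT (standing witness W4) and DOMINANT-FAR NON-LACUNARY (standing witness X3); (iii) payable clause; (iv) unconditional part ∪= the node-24 tree names after the port); PORT GO L2944 exactly as census STAGING NOTE 15 L2942 (six parts; the two docstring-preserving boundary moves approved; no privatisation). Port by census-1 gen 24 per NODE-g63.md §(11) as `RootDecomp1KSuperellipticSiegel01–06` (`--supports stmt-Schanuel-33364`; the item stays OPEN; no census credit): 01 = §L floors (section Local: the m-divisibility lemma `natCast_dvd_log_map_sub_of_pow_eq_mul_prod`,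 Siegel's factors / identity / ratio `geomSum_mul_sub_eq` / `map_sub_mul_eq_one` / `siegel_identity_pow` / `eq_of_ratio`; the cyclotomic + Kummer tower `exists_numberField_forall_mem_selmerGroup_isPow` / `exists_numberField_forall_isPow_of_dvd`; bad places `exists_finite_places`); 02 = §L main theorem `finite_integer_pow_eq_of_unitEquation` (U-binder verbatim as the tree's cubic case) + `finite_integer_pow_eq` (unconditional by `finite_unitEquation`) + `finite_integer_pow_eq_of_separable`; 03 = §E the engine on dominant LACUNARY pairs of x-degree k ≥ 3 (the `_lac` chain over node 23's `den_dvd_of_dyadic`, `def DomSuper`, `domSuper_xPolyP_iff` / `domSuper_twoTermP_iff`, the doors `siegelClause_of_domSuper` / `levelFinite_of_domSuper` / `thinFibreAt_of_domSuper` / `bddLevelEmpty_of_domSuper`, disjointness `not_domHyper_of_domSuper` / `not_domSuper_*`) (section Engine); 04 = §F the family `A j`, `tC`, `T j` (`T_eq_twoTermP`), `isEisensteinAt_A` ⇒ `domSuper_T` ⇒ `levelFinite_T` / `thinFibreAt_T` / `siegelClause_T` / … (section Family); 05 = §T part 1 (coefficient read-backs, shape refusals, the deciders' negations, GaussAt 3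 and the ladder at 3, the anchor (1, 1), the odd-prime sieves refused, real liveness) (section Territory, to be continued); 06 = §T part 2 ((T-2) `den_pow_seven_le_T` / `den_pow_lt_T` / `not_thin_ineq_two_T`, `thinFibreAt_two_iff_levelFinite_T`, `T_territory`, `T'` with `T'_zero` / `T'_one` / `T'_territory`) (section Territory re-opened with K's own open-lines). Literature / node-23 twins are CITED by name, never restated. Text = K VERBATIM (every declaration documented by the lens; statements and proofs unchanged; K's module docstring kept in part 01 below this provenance block).)
-/

noncomputable section

namespace Summit.Schanuel.Schanuel.Theorems.RootDecomp1KSuperellipticSiegel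

open Polynomial IsDedekindDomain NumberField
open scoped Classical WithZero
open Literature.NumberTheory.DiophantineGeometry (finite_unitEquation exists_finite_forall_mem_integer_algebraMap
  valuation_algebraMap_eq_one_of_mem_integer_inv valuation_eq_one_of_mul_eq_one)
open IsDedekindDomain.HeightOneSpectrum (setOf_valuation_ne_one_finite setOf_one_lt_valuation_finite)
open Summit.Schanuel.Schanuel.Theorems.RootDecomp1KHyperellipticSiegel (setOf_ne_and_valuation_sub_ne_one_finite)

/-! (section Territory, continued from part 05 — re-opened with K's own open-lines) -/

section Territory

open LiouvilleNumber
open scoped Nat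
open Summit.Schanuel.Schanuel.Theorems.RootDecomp1KDegreeLadder
open Summit.Schanuel.Schanuel.Theorems.RootDecomp1KXLinear
open Summit.Schanuel.Schanuel.Theorems.RootDecomp1KXTop
open Summit.Schanuel.Schanuel.Theorems.RootDecomp1KXAll
open Summit.Schanuel.Schanuel.Theorems.RootDecomp1KLevelFinite
open Summit.Schanuel.Schanuel.Theorems.RootDecomp1KThueMahler
open Summit.Schanuel.Schanuel.Theorems.RootDecomp1KLocalExponent
open Summit.Schanuel.Schanuel.Theorems.RootDecomp1KIntegrality (DomZero GaussAt gaussAt_xPolyP_iff thinFibreAt_of_gaussAt)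
open Summit.Schanuel.Schanuel.Theorems.RootDecomp1KSubspaceBranch (SepTopAt)
open Summit.Schanuel.Schanuel.Theorems.RootDecomp1KHeightGrading (BddLevelEmpty bddLevelEmpty_iff_levelFinite
  HeightDecidedAt)
open Summit.Schanuel.Schanuel.Theorems.RootDecomp1KDescent
open Summit.Schanuel.Schanuel.Theorems.RootDecomp1KCubicDescent
open Summit.Schanuel.Schanuel.Theorems.RootDecomp1KOddEmpty
open Summit.Schanuel.Schanuel.Theorems.RootDecomp1KSiegelGenusOne (SW sC)
open Summit.Schanuel.Schanuel.Theorems.RootDecomp1KTwoBaseCell (psNumer)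
open Summit.Schanuel.Schanuel.Theorems.RootDecomp1KRelLiouvilleCell (partialSum_two_pos
  partialSum_two_lt_liouvilleNumber liouvilleNumber_two_lt)
open Summit.Schanuel.Schanuel.Theorems.RootDecomp1KRunge (RW rwC rwC_five)
open Summit.Schanuel.Schanuel.Theorems.RootDecomp1KHyperellipticSiegel (den_dvd_of_dyadic ne_zero_of_domZero
  DomHyper M mC)

/-- **(T-2) 2-ADIC LIVENESS BY SIZE, TYPED: at a level point `(s_N, r)` of `T j`, `den(r)⁷ ≤ 2^{3·N!}`** — the
denominator of `r` is `2^e` (integrality under dominance: `den_dvd_of_dyadic`, `lc(c₀) = −1`) with `7e ≤ 3·N!`: else the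
term `2^{3·N!}·num(r)⁷` of the cleared equation is the UNIQUE one of least 2-adic order and `num(r)` would be even.
(Memo, not typed: `7e = 3·N!` is then forced, so the levels `N ∈ {2, …, 6}` — `3·N! ∉ 7ℤ` — carry NO rational point.) -/
theorem den_pow_seven_le_T (j : ℤ) (N : ℕ) {r : ℚ} (h : bev (T j) (partialSum 2 N) r = 0) :
    r.den ^ 7 ≤ 2 ^ (3 * N !) := by
  rw [← sQ_cast] at h
  have hq := ratEq_T j h
  obtain ⟨t, ht⟩ := isDyadic_sQ N
  have hsum : ∑ i ∈ Finset.range (3 + 1), sQ N ^ i * aeval r (tC j i) = 0 := by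
    rw [sum_range_lac 3 (tC j) (by norm_num) (tC_lac j), tC_zero, tC_three, map_neg, aeval_A, map_one]
    linear_combination hq
  have hdvd := den_dvd_of_dyadic 3 (tC j) (domZero_tC j) (ne_zero_of_domZero (by norm_num) (domZero_tC j)) ht hsum
  rw [tC_zero, leadingCoeff_neg, leadingCoeff_A, mul_neg_one, dvd_neg] at hdvd
  have hdvd' : r.den ∣ 2 ^ (3 * t) := by exact_mod_cast hdvd
  obtain ⟨e, -, he⟩ := (Nat.dvd_prime_pow Nat.prime_two).1 hdvd'
  rw [he, ← pow_mul]
  refine Nat.pow_le_pow_right (by norm_num) ?_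
  by_contra hlt
  push Not at hlt
  have he1 : 1 ≤ e := by omega
  have hn : (r.num : ℚ) = r * 2 ^ e := by
    have := Rat.mul_den_eq_num r
    rw [he] at this
    push_cast at this
    exact this.symm
  have hp : (psNumer 2 N : ℚ) = sQ N * 2 ^ N ! := by
    rw [sQ, div_mul_cancel₀]
    exact pow_ne_zero _ two_ne_zero
  have hq' : r ^ 7 + (4 * j + 2) * r - (4 * j + 2) - sQ N ^ 3 = 0 := by linear_combination -hq
  -- the cleared equation in `ℤ`
  have key : (2 : ℤ) ^ (3 * N !) * r.num ^ 7 + 2 ^ (6 * e + 3 * N !) * ((4 * j + 2) * r.num) -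
      2 ^ (7 * e + 3 * N !) * (4 * j + 2) - 2 ^ (7 * e) * (psNumer 2 N : ℤ) ^ 3 = 0 := by
    have hQ : (((2 : ℤ) ^ (3 * N !) * r.num ^ 7 + 2 ^ (6 * e + 3 * N !) * ((4 * j + 2) * r.num) -
        2 ^ (7 * e + 3 * N !) * (4 * j + 2) - 2 ^ (7 * e) * (psNumer 2 N : ℤ) ^ 3 : ℤ) : ℚ) =
        2 ^ (7 * e) * 2 ^ (3 * N !) * (r ^ 7 + (4 * j + 2) * r - (4 * j + 2) - sQ N ^ 3) := by
      push_cast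
      rw [hn, hp]
      ring
    rw [hq', mul_zero] at hQ
    exact_mod_cast hQ
  -- every term but the first is divisible by `2^{3·N! + 1}` (`7e > 3·N!`, `e ≥ 1`), hence so is the first
  have h1 : (2 : ℤ) ^ (3 * N ! + 1) ∣ 2 ^ (3 * N !) * r.num ^ 7 := by
    have d2 : (2 : ℤ) ^ (3 * N ! + 1) ∣ 2 ^ (6 * e + 3 * N !) * ((4 * j + 2) * r.num) :=
      (pow_dvd_pow 2 (by omega)).mul_right _
    have d3 : (2 : ℤ) ^ (3 * N ! + 1) ∣ 2 ^ (7 * e + 3 * N !) * (4 * j + 2) := (pow_dvd_pow 2 (by omega)).mul_right _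
    have d4 : (2 : ℤ) ^ (3 * N ! + 1) ∣ 2 ^ (7 * e) * (psNumer 2 N : ℤ) ^ 3 := (pow_dvd_pow 2 (by omega)).mul_right _
    have hre : (2 : ℤ) ^ (3 * N !) * r.num ^ 7 = -(2 ^ (6 * e + 3 * N !) * ((4 * j + 2) * r.num)) +
        2 ^ (7 * e + 3 * N !) * (4 * j + 2) + 2 ^ (7 * e) * (psNumer 2 N : ℤ) ^ 3 := by linear_combination key
    rw [hre]
    exact (d2.neg_right.add d3).add d4
  rw [pow_succ, mul_dvd_mul_iff_left (pow_ne_zero _ two_ne_zero)] at h1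
  have h2n : (2 : ℤ) ∣ r.num := Int.prime_two.dvd_of_dvd_pow h1
  -- … contradicting `gcd(num r, den r) = 1` with `2 ∣ den r`
  have h2nat : 2 ∣ r.num.natAbs := by simpa using Int.natAbs_dvd_natAbs.mpr h2n
  have h2den : 2 ∣ r.den := by rw [he]; exact dvd_pow_self 2 (by omega)
  have h22 : Nat.Coprime 2 2 := (Nat.Coprime.coprime_dvd_left h2nat r.reduced).coprime_dvd_right h2den
  norm_num at h22
/-- **(T-2′) HENCE `den(r)^{2N} < 2^{(N+1)!}` AT EVERY LEVEL POINT** (`(den^{2N})⁷ ≤ 2^{6N·N!} < 2^{7(N+1)!}`): node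
15's thin-fibre INEQUALITY at `m₀ = 2` (`C·2^{(N+1)!} < den(r)^{2N}`) FAILS at EVERY level point of EVERY `T j` —
`T j` is 2-ADICALLY LIVE at the residual quality; only the EMPTINESS of the far levels (Siegel) decides it. -/
theorem den_pow_lt_T (j : ℤ) (N : ℕ) {r : ℚ} (h : bev (T j) (partialSum 2 N) r = 0) :
    (r.den : ℝ) ^ (2 * N) < 2 ^ (N + 1)! := by
  have h7 := den_pow_seven_le_T j N h
  have hL := N.factorial_pos
  have key : (r.den ^ (2 * N)) ^ 7 < (2 ^ (N + 1)!) ^ 7 :=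
    calc (r.den ^ (2 * N)) ^ 7 = (r.den ^ 7) ^ (2 * N) := by ring
      _ ≤ (2 ^ (3 * N !)) ^ (2 * N) := Nat.pow_le_pow_left h7 _
      _ = 2 ^ (3 * N ! * (2 * N)) := by rw [← pow_mul]
      _ < 2 ^ ((N + 1)! * 7) := Nat.pow_lt_pow_right (by norm_num) (by rw [Nat.factorial_succ]; nlinarith)
      _ = (2 ^ (N + 1)!) ^ 7 := by rw [pow_mul]
  have hnat : r.den ^ (2 * N) < 2 ^ (N + 1)! := (Nat.pow_lt_pow_iff_left (by norm_num)).mp key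
  exact_mod_cast hnat
/-- the thin-fibre inequality of quality `2` FAILS at every level point of `T j`, for every constant `C ≥ 1`. -/
theorem not_thin_ineq_two_T (j : ℤ) (N : ℕ) {r : ℚ} (h : bev (T j) (partialSum 2 N) r = 0) {C : ℝ} (hC : 1 ≤ C) :
    ¬ C * 2 ^ (N + 1)! < (r.den : ℝ) ^ (2 * N) := by
  have h2 := den_pow_lt_T j N h
  have h3 : (2 : ℝ) ^ (N + 1)! ≤ C * 2 ^ (N + 1)! := le_mul_of_one_le_left (by positivity) hC
  intro h1; linarith
/-- **COROLLARY: ON `T j`, `ThinFibreAt 2` IS LEVEL-FINITENESS** — the quality-2 clause can only hold VACUOUSLY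
(beyond the last pointed level); both sides HOLD (`levelFinite_T`), but no `p`-adic / size argument of the record can be
the reason. -/
theorem thinFibreAt_two_iff_levelFinite_T (j : ℤ) : ThinFibreAt 2 (T j) ↔ LevelFinite (T j) := by
  refine ⟨fun hT C => ?_, fun hL => thinFibreAt_of_levelFinite hL 2⟩
  obtain ⟨N₀, hN₀⟩ := hT (max C 1)
  refine (Set.finite_lt_nat N₀).subset ?_
  rintro N ⟨r, hrC, hroot, hnd⟩
  by_contra hN
  simp only [Set.mem_setOf_eq, not_lt] at hN
  exact not_thin_ineq_two_T j N hroot (le_max_right C 1) (hN₀ N hN r (hrC.trans (le_max_left _ _)) hroot hnd)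

/-- **THE INFINITE CLASS `T j`, `j ∈ ℤ`, OF OPEN-TERRITORY PAIRS DECIDED HYPOTHESIS-FREE BY SIEGEL'S THEOREM FOR
SUPERELLIPTIC CURVES (§L, a theorem of this file) — TERRITORY, CERTIFICATES AND THEOREMS, uniformly in `j`, by tree
names:** `x`-degree 3, `Y`-degree 7 (odd), CONSTANT top `1`, `eTop = 7`, `muTop = 0`, `thinThreshold = 8`, outside
node 12's height shape, not x-linear / `XLinearLt` / `XLinTM` / norm shape / `CB` / `VW` / `SW` / `dsP` / `quinticP` /
`W4P` / `M j′` / `RW w` / `quartP`; `¬ RootlessTop e` (`e ≤ 6`) ∧ `RootlessTop 7`; `¬ DecidedAt 2`, `¬ LocalAt 2`,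
`¬ GaussAt 2` ∧ `GaussAt 3`; the two-term ladder FAILS at `2` and holds from `3`; `¬ HeightDecidedAt 2`, `¬ SepTopAt 2`;
`¬ DomHyper`; `DomSuper`; `A_j` a ℚ-IRREDUCIBLE SEPTIC (genus six); LOCALLY LIVE: the smooth anchor point `(1, 1)`
(level `1` ∈ `LevelSet (T j) 1`), `¬ OddEmptyAt ℓ`, `¬ TangentEmptyAt ℓ` at every `ℓ`; REAL-LIVE at every level;
2-ADICALLY LIVE at quality 2 ((T-2), (T-2′)); `ThinFibreAt 2 ↔ LevelFinite`; and the THEOREMS: `SiegelClause`, finitely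
many pointed levels / level ordinates / dyadic points, `LevelFinite`, `BddLevelEmpty`, `ThinFibreAt m₀` for EVERY `m₀`. -/
theorem T_territory (j : ℤ) :
    xdeg (T j) = 3 ∧ (T j).natDegree = 7 ∧ topX (T j) = 1 ∧ eTop (T j) = 7 ∧ muTop (T j) = 0 ∧
      thinThreshold (T j) = 8 ∧ ¬ (T j).natDegree < 2 * xdeg (T j) ∧
      ¬ XLinearLt (T j) ∧ ¬ XLinTM (T j) ∧ (∀ A₁ B₁, T j ≠ xLinP A₁ B₁) ∧
      (∀ g q n D, T j ≠ normShapeCurve g q n D) ∧ (∀ h₁ h₀ l₁ l₀, T j ≠ CB h₁ h₀ l₁ l₀) ∧ (∀ l, T j ≠ VW l) ∧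
      (∀ e, T j ≠ SW e) ∧ (∀ Q A₁, T j ≠ dsP Q A₁) ∧ T j ≠ quinticP ∧ T j ≠ W4P ∧ (∀ j', T j ≠ M j') ∧
      (∀ w, T j ≠ RW w) ∧ T j ≠ quartP ∧
      (∀ e, e ≤ 6 → ¬ RootlessTop e (T j)) ∧ RootlessTop 7 (T j) ∧
      ¬ DecidedAt 2 (T j) ∧ ¬ LocalAt 2 (T j) ∧ ¬ GaussAt 2 (T j) ∧ GaussAt 3 (T j) ∧
      ¬ (T j).natDegree < 3 * 2 ∧ ThinFibreAt 3 (T j) ∧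
      ¬ HeightDecidedAt 2 (T j) ∧ ¬ SepTopAt 2 (T j) ∧ ¬ DomHyper (T j) ∧ DomSuper (T j) ∧
      T j = twoTermP 3 1 (A j) ∧ Irreducible ((A j).map (Int.castRingHom ℚ)) ∧ (A j).natDegree = 7 ∧
      bev (T j) (((1 : ℤ) : ℚ) : ℝ) (((1 : ℚ)) : ℝ) = 0 ∧
      HasDerivAt (fun x => bev (T j) x (((1 : ℚ)) : ℝ)) 3 (((1 : ℤ) : ℚ) : ℝ) ∧
      HasDerivAt (fun y => bev (T j) (((1 : ℤ) : ℚ) : ℝ) y) (-(4 * j + 9)) (((1 : ℚ)) : ℝ) ∧ (-(4 * j + 9) : ℝ) ≠ 0 ∧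
      1 ∈ LevelSet (T j) 1 ∧
      (∀ ℓ, ¬ OddEmptyAt ℓ (T j)) ∧ (∀ ℓ, ¬ TangentEmptyAt ℓ (T j)) ∧
      (∀ N, ∃ r : ℝ, bev (T j) (partialSum 2 N) r = 0) ∧
      (∀ N (r : ℚ), bev (T j) (partialSum 2 N) r = 0 → r.den ^ 7 ≤ 2 ^ (3 * N !)) ∧
      (∀ N (r : ℚ), bev (T j) (partialSum 2 N) r = 0 → (r.den : ℝ) ^ (2 * N) < 2 ^ (N + 1)!) ∧
      (ThinFibreAt 2 (T j) ↔ LevelFinite (T j)) ∧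
      SiegelClause (T j) ∧ {N : ℕ | ∃ r : ℚ, bev (T j) (partialSum 2 N) r = 0}.Finite ∧
      {r : ℚ | ∃ N : ℕ, bev (T j) (partialSum 2 N) r = 0}.Finite ∧
      {p : ℚ × ℚ | IsDyadic p.1 ∧ bev (T j) p.1 p.2 = 0}.Finite ∧
      LevelFinite (T j) ∧ BddLevelEmpty (T j) ∧ (∀ m₀, ThinFibreAt m₀ (T j)) :=
  ⟨xdeg_T j, natDegree_T j, topX_T j, eTop_T j, muTop_T j, thinThreshold_T j, not_natDegree_T_lt j, not_xLinearLt_T j,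
    not_xLinTM_T j, T_ne_xLinP j, T_ne_normShapeCurve j, T_ne_CB j, T_ne_VW j, T_ne_SW j, T_ne_dsP j, T_ne_quinticP j,
    T_ne_W4P j, T_ne_M j, T_ne_RW j, T_ne_quartP j,
    fun _ he => not_rootlessTop_T j he, rootlessTop_seven_T j, not_decidedAt_T j (by norm_num), not_localAt_T j le_rfl,
    not_gaussAt_T j le_rfl, gaussAt_T j le_rfl, not_ladder_two_T j, thinFibreAt_T_of_ladder j le_rfl,
    not_heightDecidedAt_T j le_rfl, not_sepTopAt_T j (by norm_num), not_domHyper_T j, domSuper_T j,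
    T_eq_twoTermP j, (irreducible_A_cert j).1, (irreducible_A_cert j).2, bev_T_anchor j, hasDerivAt_T_anchor_x j,
    hasDerivAt_T_anchor_y j, anchor_dy_ne_zero j, one_mem_levelSet_T j,
    not_oddEmptyAt_T j, not_tangentEmptyAt_T j, T_real_live j, fun N _ h => den_pow_seven_le_T j N h,
    fun N _ h => den_pow_lt_T j N h, thinFibreAt_two_iff_levelFinite_T j, siegelClause_T j, finite_pointed_levels_T j,
    finite_ordinates_T j, finite_dyadicPoints_T j, levelFinite_T j, bddLevelEmpty_T j, thinFibreAt_T j⟩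

/-- [datum] **THE PINNED SUBFAMILY `T′ j := T (17j)`** (`17j ≡ 0 (mod 17)`: the residue the INSTRUMENT READINGS of
NODE-g63 §(10) use — `A_j mod 17` of Frobenius type `(2)(5)` for `j ≡ 0`, hence `Gal(A_j) = S₇` by Jordan; those readings
are CITED, not typed). -/
def T' (j : ℤ) : ℤ[X][X] := T (17 * j)
/-- `T′ 0 = T 0 = x³ − (Y⁷ + 2Y − 2)` — census row «node24 T 0» (LIVENESS-v29). -/
theorem T'_zero : T' 0 = T 0 := by rw [T', mul_zero]
/-- `T′ 1 = T 17 = x³ − (Y⁷ + 70Y − 70)` — census row «node24 T 17». -/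
theorem T'_one : T' 1 = T 17 := by rw [T', mul_one]
/-- **`T'_territory`**: the territory theorem for the pinned subfamily (an instance of `T_territory`). -/
theorem T'_territory (j : ℤ) :
    xdeg (T' j) = 3 ∧ (T' j).natDegree = 7 ∧ topX (T' j) = 1 ∧ eTop (T' j) = 7 ∧ muTop (T' j) = 0 ∧
      thinThreshold (T' j) = 8 ∧ ¬ (T' j).natDegree < 2 * xdeg (T' j) ∧
      ¬ XLinearLt (T' j) ∧ ¬ XLinTM (T' j) ∧ (∀ A₁ B₁, T' j ≠ xLinP A₁ B₁) ∧
      (∀ g q n D, T' j ≠ normShapeCurve g q n D) ∧ (∀ h₁ h₀ l₁ l₀, T' j ≠ CB h₁ h₀ l₁ l₀) ∧ (∀ l, T' j ≠ VW l) ∧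
      (∀ e, T' j ≠ SW e) ∧ (∀ Q A₁, T' j ≠ dsP Q A₁) ∧ T' j ≠ quinticP ∧ T' j ≠ W4P ∧ (∀ j', T' j ≠ M j') ∧
      (∀ w, T' j ≠ RW w) ∧ T' j ≠ quartP ∧
      (∀ e, e ≤ 6 → ¬ RootlessTop e (T' j)) ∧ RootlessTop 7 (T' j) ∧
      ¬ DecidedAt 2 (T' j) ∧ ¬ LocalAt 2 (T' j) ∧ ¬ GaussAt 2 (T' j) ∧ GaussAt 3 (T' j) ∧
      ¬ (T' j).natDegree < 3 * 2 ∧ ThinFibreAt 3 (T' j) ∧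
      ¬ HeightDecidedAt 2 (T' j) ∧ ¬ SepTopAt 2 (T' j) ∧ ¬ DomHyper (T' j) ∧ DomSuper (T' j) ∧
      T' j = twoTermP 3 1 (A (17 * j)) ∧ Irreducible ((A (17 * j)).map (Int.castRingHom ℚ)) ∧
      (A (17 * j)).natDegree = 7 ∧
      bev (T' j) (((1 : ℤ) : ℚ) : ℝ) (((1 : ℚ)) : ℝ) = 0 ∧
      HasDerivAt (fun x => bev (T' j) x (((1 : ℚ)) : ℝ)) 3 (((1 : ℤ) : ℚ) : ℝ) ∧
      HasDerivAt (fun y => bev (T' j) (((1 : ℤ) : ℚ) : ℝ) y) (-(4 * (17 * j) + 9)) (((1 : ℚ)) : ℝ) ∧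
      (-(4 * (17 * j) + 9) : ℝ) ≠ 0 ∧
      1 ∈ LevelSet (T' j) 1 ∧
      (∀ ℓ, ¬ OddEmptyAt ℓ (T' j)) ∧ (∀ ℓ, ¬ TangentEmptyAt ℓ (T' j)) ∧
      (∀ N, ∃ r : ℝ, bev (T' j) (partialSum 2 N) r = 0) ∧
      (∀ N (r : ℚ), bev (T' j) (partialSum 2 N) r = 0 → r.den ^ 7 ≤ 2 ^ (3 * N !)) ∧
      (∀ N (r : ℚ), bev (T' j) (partialSum 2 N) r = 0 → (r.den : ℝ) ^ (2 * N) < 2 ^ (N + 1)!) ∧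
      (ThinFibreAt 2 (T' j) ↔ LevelFinite (T' j)) ∧
      SiegelClause (T' j) ∧ {N : ℕ | ∃ r : ℚ, bev (T' j) (partialSum 2 N) r = 0}.Finite ∧
      {r : ℚ | ∃ N : ℕ, bev (T' j) (partialSum 2 N) r = 0}.Finite ∧
      {p : ℚ × ℚ | IsDyadic p.1 ∧ bev (T' j) p.1 p.2 = 0}.Finite ∧
      LevelFinite (T' j) ∧ BddLevelEmpty (T' j) ∧ (∀ m₀, ThinFibreAt m₀ (T' j)) := by
  have h := T_territory (17 * j)
  push_cast at h ⊢
  exact h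
/-- **`∀ j m₀, ThinFibreAt m₀ (T′ j)`** — the pinned subfamily, hypothesis-free. -/
theorem thinFibreAt_T' (j : ℤ) (m₀ : ℕ) : ThinFibreAt m₀ (T' j) := thinFibreAt_T _ m₀
/-- `(j : ℤ) : LevelFinite (T' j)`. -/
theorem levelFinite_T' (j : ℤ) : LevelFinite (T' j) := levelFinite_T _

end Territory

end Summit.Schanuel.Schanuel.Theorems.RootDecomp1KSuperellipticSiegel

end
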